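/-
Copyright: statement-level skeleton of a published paper (lit-balaban cell, Phase-2 proof seat p33 gen 69). No claims beyond
what the kernel checks below.
-/
import Literature.MathematicalPhysics.QuantumFieldTheory.Balaban1983to89.B3Eq218Pictures
import Literature.MathematicalPhysics.QuantumFieldTheory.Balaban1983to89.B3Eq123Counterterms

/-!
# B3 — T. Bałaban, *(Higgs)₂,₃ quantum fields in a finite volume. III. Renormalization*, Commun. Math. Phys. **88** (1983)
411–445 [Balaban1983Higgs3] — p. 420 [PDF 10]: **the orders d_s(G), d_v(G) and the sentence "The numbers d_s(G), d_v(G) are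
well-defined for G_ren because all graphs in the family G_ren have the same orders"**, DECIDED CLASS BY CLASS on the typed model
classes of pp. 429–430 ((2.18), (2.19), (2.20), (2.22)) and of (1.22)/(1.23), together with the bookkeeping that makes the
sentence true for the classes with a mass-renormalization vertex (1.7): the vertex carries the orders of its counterterm's graph

statement-level skeleton of published theorems with citation tags; proofs where landed; nothing here is a claim about the
Yang–Mills mass gap

PDF held: `paper:balaban1983-higgs-2-3-quantum-fields-finite-volume` (journal page = PDF page + 410).  p. 420 read FIRST-HAND on the
×2 render `run/shared/lean/pub/pub-balaban/b2b-balaban-ref1/pages/1983-cmp88-higgs23-III/1983-cmp88-higgs23-III-p010-x2.png`, the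
class displays (2.18)–(2.22) on `…-p019-x2.png` / `…-p020-x2.png` (pp. 429–430), (1.22)/(1.23) on `…-p006/p007-x2.png`.

CITATION HEADER (lean-in-tree rule).  lit-balaban MEGA-FORMALIZATION (HOME `run/shared/lean/pub/lit-balaban/`), Phase 2, seat
**p33 gen 69** (unit `lit-balaban-p33-g69`), free-target protocol G.5-34(d) (TAKING HOME/STATUS.md 2026-08-23T07:31:19Z; the target
named by the fold owner r15 in `lit-balaban-r15/B3-CLOSURE.md` v1.29 §5 item 19, verbatim: *"«The numbers d_s(G), d_v(G) are
well-defined for G_ren because all graphs in the family G_ren have the same orders» is not proved — on p18's model classes it is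
decidable per class: FREE TARGET S"*).  ROW **B3.Def@420** of `HOME/lit-balaban-r15/ROWS-B3.md` (fold owner r15), CELLS ONLY (the
head is the owner's call; the localization half of the row is `B3SmoothLocalization420`, p33 g62).
REUSED BY NAME, nothing re-declared: r15's `B3Prop1.VertexKind.ds/dv`, `dsOf`/`dvOf` (the decls carrying the p. 420 sentence);
p18's graphs `B3Cor23Concrete.Graph`, census `B3Sect3DegreeCensus.eOrder`/`numV16`, (2.18)–(2.21f) `B3Sect2ThreeLegGraphs.g218 … g221f`,
(3.6) `B3Sect3LowestOrderGraphs.g36a/b/c`, (1.22)⑦/(1.23)⑦⑧⑨ `B3Sect1Graphs122.g122g/g123g/h/i`; p26's `B3Eq37Pictures.LocPicture`, classes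
`B3Eq218Pictures.pair218/219/220`, `pics221`, `pics222`, `class222`, the (1.7)-graph `g221g`, and `B3Eq123Counterterms.pics122/pics123`.

THE PRINTED TEXT.  p. 420 [PDF 10], verbatim: *"Our last preparatory remark is most strictly connected with renormalization. We
gather some graphs into families denoted G_ren. In the next chapter we will describe precisely how it is done; let us mention only
that an ultimate aim is to cancel divergencies. For example if a graph G contains a subgraph G₀ with two external scalar legs and
the expression corresponding to G₀ is divergent, then we add another graph G′ which is obtained from G by replacing G₀ by the vertex
(1.7) with the counterterm δm²_{G₀}(x). Let us denote by E(G, {□(v)}_{v∈G}, Φ_ext, A_ext) the expression corresponding to graph G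
with localizations {□(v)}_{v∈G} and external fields Φ_ext, A_ext. The same symbol with G_ren instead of G denotes a sum of these
expressions for G ∈ G_ren. Let us denote by d_s(v) an order of the coupling constant λ for the vertex v, and by d_v(v) an order of
the coupling constant e. Finally let d_s(G) = Σ_{v∈G} d_s(v), d_v(G) = Σ_{v∈G} d_v(v). The numbers d_s(G), d_v(G) are well-defined
for G_ren because all graphs in the family G_ren have the same orders."*  p. 429 [PDF 19]: *"the classes G_ren are defined as the
smallest sets of graphs, symmetric with respect to permutation of external scalar field legs and with each divergent subgraph
renormalized, e.g. each pair of graphs below form one class: (2.18) (2.19) (2.20)"*; p. 430 [PDF 20]: *"In fact the only other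
divergent graphs of this class are: (a) … (g) (2.21) and permuted graphs, and some of them have divergent subgraphs. We form classes
collecting all graphs necessary to renormalize each divergent subgraph, e.g. we take as one class [two pictures] and permuted graphs
(2.22) … We form classes G_ren for these graphs taking all graphs necessary to renormalize all divergent proper subgraphs, and
adding one-vertex graphs of the form —•— [δm²_k(G)] with mass renormalization counterterms corresponding to the previous graphs, so
we take one counterterm for each graph."*

WHAT IS TYPED / PROVED (sorry-free; the `def`s have bodies; no `Prop` fact; standard axioms).
* §1 `dsG G` / `dvG G` := r15's `dsOf univ G.kind` / `dvOf univ G.kind` — print's d_s(G) = Σ_{v∈G} d_s(v), d_v(G) = Σ_{v∈G} d_v(v)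
  on p18's graphs; `orders G = (d_s(G), d_v(G))`; **dictionary** `dvG_eq_eOrder` (d_v(G) IS p18's `eOrder`), `dsG_eq_numV16` (d_s(G) IS
  the number of vertices (1.6), p18's `numV16` — the vertex (1.6) is the only one carrying λ); **relabelling invariance**
  `orders_eq_of_relabel` (the orders depend on the vertex kinds up to a bijection of the vertex labels — print's *"permuted graphs"*
  have the same orders) and `orders_loc` (a localized picture has the orders of its drawn graph, whatever the localization).
* §2 THE SENTENCE, CLASS BY CLASS: `SameOrders cls` := every two members of the typed class `cls` have the same (d_s, d_v);
  `classOrders` := the orders of a class, and **`classOrders_eq`**: they equal the orders of EVERY member when `SameOrders` holds — the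
  typed form of *"well-defined for G_ren"*.  DECIDED (kernel computation, `rfl`): the pair (2.18) has orders (0, 3) for both members
  (`orders_pair218`, `sameOrders_pair218`), likewise (2.19) (`…219`), (2.20) (`…220`), and the class (2.22) — graph, counterterm
  picture, and the two permuted members (`orders_class222`, `sameOrders_class222`, all (0, 3)); hence `classOrders` of each = (0, 3).
  CONTROL (decided too): the seven divergent graphs (2.21a)–(2.21g) are NOT one class and indeed do NOT have equal orders —
  (a)–(e) (0, 3), (f) (1, 1), (g) (0, 1) with the bare (1.7) vertex (`orders_pics221`, `not_sameOrders_pics221`); the seven pictures of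
  (1.22) have orders (1,0), (0,2), (0,4), (0,2), (0,4), (2,0), (0,2) and the nine of (1.23) end with (1,2), (0,4), (0,4) for ⑦⑧⑨
  (`orders_pics122`, `orders_pics123`).
* §3 THE COUNTERTERM VERTEX.  The typed `VertexKind.ds/dv` give the vertex (1.7) the orders (0, 0) (r15, `B3Prop1`: *"the counterterm
  vertex (1.7) carries its order through δm²_G, (1.29), not through an explicit factor; typed 0 here and recorded as a reading"*).
  Print's sentence is about the graph G′ whose (1.7)-vertex carries δm²_{G₀} — *"one counterterm for each graph"* (p. 430) —, i.e. the
  orders (d_s(G₀), d_v(G₀)) (p. 417: *"A term e^αλ^βΣ^ε_{(α,β)} can be written also as a sum of terms Σ^ε_G … The same for the term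
  e^αλ^βδm²_{(α,β)}, and we define δm²_G by the equation −δm²_G + Σ_{x∈T_ε}ε^dΣ^ε_G(x) = 0"* — δm²_{G₀} comes with the couplings of G₀).  `ordersCt G ct`
  := the orders of G when the vertex i carries in addition the orders `ct i` (the counterterm hung at i; 0 at the other vertices);
  **`ordersCt_eq`**: = orders(G) + Σ_i ct i (ADDITIVITY — the content of print's *"because"*); **`orders_attach`**: for ANY graph G′
  whose vertices are those of G except one vertex (1.7), together with those of G₀ (the attached form of (2.3) p. 423, *"a graph G′
  obtained from G by attaching the corresponding graphs to the mass renormalization vertices"*), orders(G′) = orders(G) + orders(G₀)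
  — so G′ ∈ G_ren and the counterterm graph have the same orders.  DECIDED INSTANCES: (2.21g) with δm²_{(3.6)₁} / δm²_{(3.6)₂} /
  δm²_{(3.6)₃} has the orders (0, 3) / (0, 3) / (1, 1) of (2.21b) = (2.22)₁ / (2.21d) / (2.21f) (`ordersCt_g221g`; cf. p26's degree
  twin `B3Eq218Pictures.deg23_g221g` and `attach36a_221b`/`attach36b_221d`/`attach36c_221f`), and (1.22)⑦ with δm²_① / δm²_② / δm²_④ has
  the orders (1, 2) / (0, 4) / (0, 4) of the attached graphs (1.23)⑦ / ⑧ / ⑨ (`ordersCt_g122g`; the orders twin of p18's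
  `B3Sect1Graphs122.deg23_picture7`); so each class {(2.21f), (2.21g)[δm²_{(3.6)₃}]}, {(2.21d), (2.21g)[δm²_{(3.6)₂}]}, {(2.22)₁, (2.22)₂,
  (2.21g)[δm²_{(3.6)₁}]} has well-defined orders (`sameOrders_with_counterterm`), while under the bare reading (2.21g) ≠ (2.21f)
  (`bare_reading_differs`).  `orders_attach` is exercised on (2.21g) + (3.6)₃ = (2.21f) with the explicit vertex bijection
  (`orders_g221f_attach`).
HONEST SCOPE.  (i) Print's G_ren are defined inductively in Sect. 2 for ALL graphs; typed here are exactly the classes print DRAWS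
((2.18), (2.19), (2.20), (2.22) with p26's conservative reading of *"permuted graphs"*) and the (1.22)/(1.23) pictures; for any further
typed class the additivity lemmas `ordersCt_eq`/`orders_attach` apply once its members are listed.  (ii) Combinatoric factors,
1PI-ness and the analytic E(G, …) are not touched (r15's `B3Prop1.Expansion` keeps d_s(G_ren), d_v(G_ren) as fields `ds`/`dv` of the
abstract carrier; this file computes them on the model classes, it does not instantiate the carrier).  (iii) (1.22)⑦ with δm² = δm²₁
(= ① + ② + ④, p. 417) is, per p. 430's *"one counterterm for each graph"*, a SUM over three classes with orders (1,2), (0,4), (0,4), all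
of combined order α + 2β = 4 (`combined_pics123`, p18's `pictures122_order` convention).  0 sorry, 0 new `Prop` facts.  Unit
`lit-balaban-p33` gen 69 (literature-prover-lit-balaban-p33-g69-0), HOME `run/shared/lean/pub/lit-balaban/`, 2026-08-23.
-/

open Finset

namespace Literature.MathematicalPhysics.QuantumFieldTheory.Balaban1983to89.B3ClassOrders420

open B3Prop1 B3Cor23Concrete B3Sect2ThreeLegGraphs B3Eq37Pictures B3Eq335Pictures B3Sect3LowestOrderGraphs B3Sect3Graphs318
  B3Sect3DegreeCensus B3Sect1Graphs122 B3Eq218Pictures B3Eq123Counterterms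

/-! ## §1 d_s(G), d_v(G) on the model graphs -/

section Orders

variable {nbar : ℕ}

/-- **d_s(G) = Σ_{v∈G} d_s(v)** p. 420 on p18's graphs: r15's `dsOf` over all vertices of `G` (d_s(v) = `VertexKind.ds`: 1 for the
vertex (1.6), 0 otherwise). [cite: Balaban1983Higgs3, p.420] -/
def dsG (G : Graph nbar) : ℕ := dsOf univ G.kind

/-- **d_v(G) = Σ_{v∈G} d_v(v)** p. 420 on p18's graphs: r15's `dvOf` over all vertices (d_v(v) = `VertexKind.dv`, the exponent of
e(L^kε) printed in (1.8)–(1.15)). [cite: Balaban1983Higgs3, p.420] -/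
def dvG (G : Graph nbar) : ℕ := dvOf univ G.kind

/-- The pair of orders (d_s(G), d_v(G)) of a graph — *"the same orders"* of p. 420 compares both. [cite: Balaban1983Higgs3, p.420] -/
def orders (G : Graph nbar) : ℕ × ℕ := (dsG G, dvG G)

/-- d_s(G), d_v(G) unfolded: Σ_i d_s(kind i), Σ_i d_v(kind i). [cite: Balaban1983Higgs3, p.420] -/
theorem orders_eq_sum (G : Graph nbar) : orders G = (∑ i, (G.kind i).ds, ∑ i, (G.kind i).dv) := rfl

/-- **dictionary**: d_v(G) IS p18's e-order `eOrder G` of the degree census (`B3Sect3DegreeCensus`). [cite: Balaban1983Higgs3, p.420] -/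
theorem dvG_eq_eOrder (G : Graph nbar) : dvG G = eOrder G := rfl

/-- **dictionary**: d_s(G) IS the number of vertices (1.6) of G, p18's `numV16 G` — the φ⁴ vertex (1.6) is the only vertex of the
catalogue with an explicit factor λ. [cite: Balaban1983Higgs3, (1.6) p.413, p.420] -/
theorem dsG_eq_numV16 (G : Graph nbar) : dsG G = numV16 G := by
  unfold dsG dsOf numV16
  rw [Finset.card_filter]
  refine Finset.sum_congr rfl fun i _ => ?_
  cases G.kind i <;> rfl

/-- kernel: r15's `dsOf` over all vertices is invariant under a bijective relabelling of the vertices. [cite: Balaban1983Higgs3, p.420] -/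
theorem dsOf_univ_comp_equiv {ι κ : Type} [Fintype ι] [Fintype κ] (σ : ι ≃ κ) (kind : κ → VertexKind) :
    dsOf univ (kind ∘ σ) = dsOf univ kind := by
  unfold dsOf
  exact Equiv.sum_comp σ (fun v => (kind v).ds)

/-- kernel: the same for `dvOf`. [cite: Balaban1983Higgs3, p.420] -/
theorem dvOf_univ_comp_equiv {ι κ : Type} [Fintype ι] [Fintype κ] (σ : ι ≃ κ) (kind : κ → VertexKind) :
    dvOf univ (kind ∘ σ) = dvOf univ kind := by
  unfold dvOf
  exact Equiv.sum_comp σ (fun v => (kind v).dv)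

/-- **The orders depend on the vertices only, up to relabelling**: if the vertices of `G′` are those of `G` under a bijection
preserving the kinds, then (d_s, d_v)(G′) = (d_s, d_v)(G) — in particular print's *"permuted graphs"* (p. 429/430: the members of a
class obtained by permuting the external scalar legs, typed by p26 as vertex-relabelled graphs, `B3Eq218Pictures.other218'_swap`)
have the same orders, whatever their lines. [cite: Balaban1983Higgs3, p.420, (2.18) p.429] -/
theorem orders_eq_of_relabel {G G' : Graph nbar} (σ : Fin G.nV ≃ Fin G'.nV) (h : ∀ i, G'.kind (σ i) = G.kind i) :
    orders G' = orders G := by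
  have hk : G'.kind ∘ σ = G.kind := funext h
  unfold orders dsG dvG
  rw [← hk, dsOf_univ_comp_equiv, dvOf_univ_comp_equiv]

/-- **A localized picture has the orders of its drawn graph** — the localization {□(v)} (and p. 417's drawing convention for
counterterm pictures) does not touch the vertices. [cite: Balaban1983Higgs3, p.420, p.417] -/
theorem orders_loc (p : LocPicture nbar) (loc' : Leg p.G.kind → Fin p.G.nV) (h : ∀ x, (p.G.other x).isSome → loc' x = x.1) :
    orders (⟨p.G, loc', h⟩ : LocPicture nbar).G = orders p.G := rfl

/-- (2.18)₂ has the orders of (2.18)₁ BY RELABELLING (p26's `other218'_swap`: the kinds correspond under `0 ↔ 1`), before any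
computation. [cite: Balaban1983Higgs3, (2.18) p.429] -/
theorem orders_g218'_relabel (hn : 1 ≤ nbar) : orders (g218' nbar hn) = orders (g218 nbar hn) :=
  orders_eq_of_relabel (G := g218 nbar hn) (G' := g218' nbar hn) Fin.revPerm fun i => by
    show kind218' (Fin.rev i) = kind218 i
    rw [other218'_swap.1 (Fin.rev i), Fin.rev_rev]

end Orders

/-! ## §2 "all graphs in the family G_ren have the same orders" — the typed classes, decided -/

section Classes

variable {nbar : ℕ}

/-- **"all graphs in the family G_ren have the same orders"** for a typed class (a list of localized pictures, p26's format): every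
two members have the same (d_s, d_v). [cite: Balaban1983Higgs3, p.420] -/
def SameOrders (cls : List (LocPicture nbar)) : Prop :=
  ∀ p ∈ cls, ∀ q ∈ cls, orders p.G = orders q.G

/-- **d_s(G_ren), d_v(G_ren)**: the orders of a (nonempty) class, read off its first member … [cite: Balaban1983Higgs3, p.420] -/
def classOrders (cls : List (LocPicture nbar)) (h : cls ≠ []) : ℕ × ℕ := orders (cls.head h).G

/-- … **are well-defined** — equal to the orders of EVERY member — exactly when the class has the same orders throughout (print's
*"because"*). [cite: Balaban1983Higgs3, p.420] -/
theorem classOrders_eq {cls : List (LocPicture nbar)} (hS : SameOrders cls) (h : cls ≠ []) {p : LocPicture nbar} (hp : p ∈ cls) :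
    classOrders cls h = orders p.G :=
  hS _ (List.head_mem h) _ hp

/-- kernel: a class all of whose members have the orders `o` has the same orders throughout. [cite: Balaban1983Higgs3, p.420] -/
theorem sameOrders_of_forall {cls : List (LocPicture nbar)} (o : ℕ × ℕ) (h : ∀ p ∈ cls, orders p.G = o) : SameOrders cls :=
  fun p hp q hq => by rw [h p hp, h q hq]

/-- kernel: the same, from the computed list of orders. [cite: Balaban1983Higgs3, p.420] -/
theorem sameOrders_of_map {cls : List (LocPicture nbar)} (o : ℕ × ℕ)
    (h : cls.map (fun p => orders p.G) = List.replicate cls.length o) : SameOrders cls :=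
  sameOrders_of_forall o fun p hp => List.eq_of_mem_replicate (h ▸ List.mem_map.2 ⟨p, hp, rfl⟩)

variable (hn : 1 ≤ nbar) (hn2 : 2 ≤ nbar) (hn4 : 4 ≤ nbar)

/-- **(2.18)**, decided: both members of the pair have d_s = 0, d_v = 3 ((1.8)_{1,1}: e², (1.8)_{1,0}: e).
[cite: Balaban1983Higgs3, (2.18) p.429, p.420] -/
theorem orders_pair218 : (pair218 hn).map (fun p => orders p.G) = [(0, 3), (0, 3)] := rfl

/-- **(2.19)**, decided: both members have d_s = 0, d_v = 3 ((1.10)_{1,1}: e², (1.8)_{1,0}: e). [cite: Balaban1983Higgs3, (2.19) p.429, p.420] -/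
theorem orders_pair219 : (pair219 hn).map (fun p => orders p.G) = [(0, 3), (0, 3)] := rfl

/-- **(2.20)**, decided: both members of the triangle pair have d_s = 0, d_v = 3 (three vertices (1.8) with n + n′ = 1).
[cite: Balaban1983Higgs3, (2.20) p.429, p.420] -/
theorem orders_pair220 : (pair220 hn).map (fun p => orders p.G) = [(0, 3), (0, 3)] := rfl

/-- **(2.22)** with its permuted members (p26's `class222`), decided: all four have d_s = 0, d_v = 3 — the counterterm picture
(2.22)₂ has the same drawn graph as (2.22)₁ (p. 417's convention), the permuted members are relabelled graphs.
[cite: Balaban1983Higgs3, (2.22) p.430, p.420] -/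
theorem orders_class222 : (class222 hn).map (fun p => orders p.G) = [(0, 3), (0, 3), (0, 3), (0, 3)] := rfl

/-- the two drawn pictures of (2.22) alone. [cite: Balaban1983Higgs3, (2.22) p.430] -/
theorem orders_pics222 : (pics222 hn).map (fun p => orders p.G) = [(0, 3), (0, 3)] := rfl

/-- **The sentence holds for the class (2.18).** [cite: Balaban1983Higgs3, p.420, (2.18) p.429] -/
theorem sameOrders_pair218 : SameOrders (pair218 hn) := sameOrders_of_map (0, 3) (orders_pair218 hn)

/-- **The sentence holds for the class (2.19).** [cite: Balaban1983Higgs3, p.420, (2.19) p.429] -/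
theorem sameOrders_pair219 : SameOrders (pair219 hn) := sameOrders_of_map (0, 3) (orders_pair219 hn)

/-- **The sentence holds for the class (2.20).** [cite: Balaban1983Higgs3, p.420, (2.20) p.429] -/
theorem sameOrders_pair220 : SameOrders (pair220 hn) := sameOrders_of_map (0, 3) (orders_pair220 hn)

/-- **The sentence holds for the class (2.22) (with permuted members).** [cite: Balaban1983Higgs3, p.420, (2.22) p.430] -/
theorem sameOrders_class222 : SameOrders (class222 hn) := sameOrders_of_map (0, 3) (orders_class222 hn)

/-- Hence **d_s(G_ren) = 0, d_v(G_ren) = 3 are well-defined** for the four typed classes of the two-scalar-one-vector-leg graphs: the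
orders of (2.18), (2.19), (2.20), (2.22) read off any member. [cite: Balaban1983Higgs3, p.420, (2.18)–(2.22) pp.429–430] -/
theorem classOrders_threeLeg :
    classOrders (pair218 hn) (List.cons_ne_nil _ _) = (0, 3) ∧ classOrders (pair219 hn) (List.cons_ne_nil _ _) = (0, 3) ∧
    classOrders (pair220 hn) (List.cons_ne_nil _ _) = (0, 3) ∧ classOrders (class222 hn) (List.cons_ne_nil _ _) = (0, 3) :=
  ⟨rfl, rfl, rfl, rfl⟩

/-- CONTROL, decided: the seven divergent graphs **(2.21a)–(2.21g)** p. 430 have the orders (0,3), (0,3), (0,3), (0,3), (0,3), (1,1)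
and — with the BARE vertex (1.7) of the typed catalogue — (0,1). [cite: Balaban1983Higgs3, (2.21) p.430, p.420] -/
theorem orders_pics221 :
    (pics221 hn2).map (fun p => orders p.G) = [(0, 3), (0, 3), (0, 3), (0, 3), (0, 3), (1, 1), (0, 1)] := rfl

/-- … so the LIST (2.21) is not one class G_ren and does not have "the same orders" ((2.21f) carries λ): print's sentence is about the
classes ((2.22), "one counterterm for each graph"), not about the set of divergent graphs. [cite: Balaban1983Higgs3, (2.21) p.430, p.420] -/
theorem not_sameOrders_pics221 : ¬ SameOrders (pics221 hn2) := by
  intro h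
  have hmem : ∀ o ∈ (pics221 hn2).map (fun p => orders p.G), o = (0, 3) := by
    intro o ho
    obtain ⟨p, hp, rfl⟩ := List.mem_map.1 ho
    have h0 : pic221a (le_trans one_le_two hn2) ∈ pics221 hn2 := List.mem_cons_self
    rw [h p hp _ h0]
    rfl
  have h11 : ((1 : ℕ), (1 : ℕ)) ∈ (pics221 hn2).map (fun p => orders p.G) := by
    rw [orders_pics221]; simp
  exact absurd (hmem _ h11) (by decide)

/-- **(1.22)** p. 416, decided: the orders of the seven pictures ① (1,0), ② (0,2), ③ (0,4), ④ (0,2), ⑤ (0,4), ⑥ (2,0), ⑦ (0,2) (⑦ with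
the bare vertex (1.7)). [cite: Balaban1983Higgs3, (1.22) p.416, p.420] -/
theorem orders_pics122 :
    (pics122 hn hn2 hn4).map (fun p => orders p.G) = [(1, 0), (0, 2), (0, 4), (0, 2), (0, 4), (2, 0), (0, 2)] := rfl

/-- **(1.23)** p. 417, decided: ①–⑥ as in (1.22) (counterterm pictures have the graph's orders, `orders_loc`), and the attached graphs
⑦ (1,2), ⑧ (0,4), ⑨ (0,4). [cite: Balaban1983Higgs3, (1.23) p.417, p.420] -/
theorem orders_pics123 :
    (pics123 hn hn2 hn4).map (fun p => orders p.G) =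
      [(1, 0), (0, 2), (0, 4), (0, 2), (0, 4), (2, 0), (1, 2), (0, 4), (0, 4)] := rfl

/-- The combined coupling order α + 2β (α = d_v, β = d_s; p. 417 *"terms δm²_{(α,β)} of the order α + 2β"*) of the nine pictures of
(1.23): 2, 2, 4, 2, 4, 4 and 4, 4, 4 for ⑦⑧⑨ — p18's `B3Sect1Graphs122.pictures122_order`, re-derived from (d_s, d_v).
[cite: Balaban1983Higgs3, (1.23) p.417] -/
theorem combined_pics123 :
    (pics123 hn hn2 hn4).map (fun p => dvG p.G + 2 * dsG p.G) = [2, 2, 4, 2, 4, 4, 4, 4, 4] := rfl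

end Classes

/-! ## §3 The mass-renormalization vertex (1.7) carries the orders of its counterterm's graph -/

section Counterterm

variable {nbar : ℕ}

/-- The typed catalogue gives the vertex (1.7) the orders d_s = d_v = 0 (r15's reading in `B3Prop1.VertexKind.ds/dv`: the order of
(1.7) sits in δm²_G, (1.29), not in an explicit factor). [cite: Balaban1983Higgs3, (1.7) p.413, p.420] -/
theorem orders_v17_bare : VertexKind.v17.ds = 0 ∧ VertexKind.v17.dv = 0 := ⟨rfl, rfl⟩

/-- **The orders of a graph whose vertex `i` carries, in addition, the orders `ct i`** — for a vertex (1.7) with the counterterm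
δm²_{G₀}: `ct i = orders G₀` (p. 430 *"one counterterm for each graph"*; p. 417: the term e^αλ^βδm²_{(α,β)} is the sum of the δm²_G over
the graphs G of that order, so δm²_{G₀} carries the couplings of G₀); `ct i = 0` at the other vertices. [cite: Balaban1983Higgs3, p.420, p.417, p.430] -/
def ordersCt (G : Graph nbar) (ct : Fin G.nV → ℕ × ℕ) : ℕ × ℕ :=
  (∑ i, ((G.kind i).ds + (ct i).1), ∑ i, ((G.kind i).dv + (ct i).2))

/-- **ADDITIVITY** — the content of print's *"because"*: the orders with counterterms = the orders of the graph + the orders carried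
by the counterterms. [cite: Balaban1983Higgs3, p.420] -/
theorem ordersCt_eq (G : Graph nbar) (ct : Fin G.nV → ℕ × ℕ) :
    ordersCt G ct = (dsG G + ∑ i, (ct i).1, dvG G + ∑ i, (ct i).2) := by
  unfold ordersCt dsG dvG dsOf dvOf
  rw [Finset.sum_add_distrib, Finset.sum_add_distrib]

/-- no counterterm: the plain orders. [cite: Balaban1983Higgs3, p.420] -/
theorem ordersCt_zero (G : Graph nbar) : ordersCt G (fun _ => (0, 0)) = orders G := by
  rw [ordersCt_eq]
  simp [orders]

/-- one counterterm of orders `o` at the vertex `i₀`: orders(G) + o. [cite: Balaban1983Higgs3, p.420, p.430] -/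
theorem ordersCt_single (G : Graph nbar) (i₀ : Fin G.nV) (o : ℕ × ℕ) :
    ordersCt G (Pi.single i₀ o) = orders G + o := by
  rw [ordersCt_eq, orders, Prod.mk_add_mk]
  congr 1
  · rw [Finset.sum_eq_single i₀ (fun j _ hj => by rw [Pi.single_eq_of_ne hj, Prod.fst_zero]) (fun h => absurd (mem_univ _) h),
      Pi.single_eq_same]
  · rw [Finset.sum_eq_single i₀ (fun j _ hj => by rw [Pi.single_eq_of_ne hj, Prod.snd_zero]) (fun h => absurd (mem_univ _) h),
      Pi.single_eq_same]

/-- **THE ATTACHED FORM GIVES THE SAME ORDERS** ((2.3) p. 423: *"the degree of G is the same as the degree of a graph G′ obtained from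
G by attaching the corresponding graphs to the mass renormalization vertices"* — here for the ORDERS): if the vertices of `G′` are,
under a kind-preserving bijection, the vertices of `G` other than one vertex `i₀` of kind (1.7) together with the vertices of `G₀`,
then (d_s, d_v)(G′) = (d_s, d_v)(G) + (d_s, d_v)(G₀) — so G (with the counterterm δm²_{G₀} at `i₀`, `ordersCt_single`) and G′ have
the same orders, which is why d_s, d_v are well-defined on the class {G′, G}. [cite: Balaban1983Higgs3, p.420, (2.3) p.423] -/
theorem orders_attach {G G₀ G' : Graph nbar} (i₀ : Fin G.nV) (hi₀ : G.kind i₀ = .v17)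
    (e : {i : Fin G.nV // i ≠ i₀} ⊕ Fin G₀.nV ≃ Fin G'.nV)
    (hG : ∀ i : {i : Fin G.nV // i ≠ i₀}, G'.kind (e (.inl i)) = G.kind i.1)
    (hG₀ : ∀ j : Fin G₀.nV, G'.kind (e (.inr j)) = G₀.kind j) :
    orders G' = orders G + orders G₀ := by
  have key : ∀ f : VertexKind → ℕ, f .v17 = 0 →
      ∑ i, f (G'.kind i) = ∑ i, f (G.kind i) + ∑ j, f (G₀.kind j) := by
    intro f hf
    rw [← Equiv.sum_comp e (fun i => f (G'.kind i)), Fintype.sum_sum_type]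
    simp only [hG, hG₀]
    congr 1
    -- Σ over the vertices ≠ i₀ of f(kind) = Σ over all vertices, the i₀-term being f(v17) = 0
    have h1 : ∑ i : {i : Fin G.nV // i ≠ i₀}, f (G.kind i.1) = ∑ i ∈ univ.erase i₀, f (G.kind i) :=
      (Finset.sum_subtype (univ.erase i₀) (fun x => by simp) (fun i => f (G.kind i))).symm
    rw [h1, ← Finset.add_sum_erase univ (fun i => f (G.kind i)) (mem_univ i₀), hi₀, hf, zero_add]
  unfold orders dsG dvG dsOf dvOf
  rw [Prod.mk_add_mk, key (fun v => v.ds) rfl, key (fun v => v.dv) rfl]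

variable (hn : 1 ≤ nbar) (hn2 : 2 ≤ nbar)

/-- **(2.21g) with its counterterm**, decided: the vertex (1.7) of (2.21g) carrying δm²_{(3.6)₁} / δm²_{(3.6)₂} / δm²_{(3.6)₃} (the three
lowest-order scalar self-energy graphs, p. 435 = ④ ② ① of (1.22)) gives (2.21g) the orders (0,3) / (0,3) / (1,1) = those of the
attached graphs (2.21b) = (2.22)₁ / (2.21d) / (2.21f) (p26's `attach36a_221b`/`attach36b_221d`/`attach36c_221f` name the attachments;
`deg23_g221g` is the degree twin). [cite: Balaban1983Higgs3, (2.21)–(2.22) p.430, (2.3) p.423, p.420] -/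
theorem ordersCt_g221g :
    ordersCt (g221g nbar hn) ![(0, 0), orders (g36a nbar hn)] = orders (g221b nbar hn) ∧
    ordersCt (g221g nbar hn) ![(0, 0), orders (g36b nbar hn2)] = orders (g221d nbar hn2) ∧
    ordersCt (g221g nbar hn) ![(0, 0), orders (g36c nbar)] = orders (g221f nbar hn) := ⟨rfl, rfl, rfl⟩

/-- **(1.22)⑦ with its counterterm**, decided: the vertex (1.7) of ⑦ (`g122g`, vertex `2`) carrying δm²_① / δm²_② / δm²_④ gives ⑦ the
orders (1,2) / (0,4) / (0,4) of the attached graphs (1.23)⑦ / ⑧ / ⑨ (`g123g`/`g123h`/`g123i`) — the orders twin of p18's degree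
identity `deg23_picture7`. [cite: Balaban1983Higgs3, (1.22) p.416, (1.23) p.417, p.420] -/
theorem ordersCt_g122g :
    ordersCt (g122g nbar hn) ![(0, 0), (0, 0), orders (g36c nbar)] = orders (g123g nbar hn) ∧
    ordersCt (g122g nbar hn) ![(0, 0), (0, 0), orders (g36b nbar hn2)] = orders (g123h nbar hn2) ∧
    ordersCt (g122g nbar hn) ![(0, 0), (0, 0), orders (g36a nbar hn)] = orders (g123i nbar hn) := ⟨rfl, rfl, rfl⟩

/-- **Under the BARE reading the sentence would fail**: (2.21g) with the vertex (1.7) of orders (0,0) has (d_s, d_v) = (0,1), not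
the (1,1) of (2.21f) nor the (0,3) of (2.21b)/(2.21d) — the counterterm's orders are what print's G′ carries.
[cite: Balaban1983Higgs3, (2.21) p.430, p.420] -/
theorem bare_reading_differs :
    orders (g221g nbar hn) = (0, 1) ∧ orders (g221g nbar hn) ≠ orders (g221f nbar hn) ∧
    orders (g221g nbar hn) ≠ orders (g221b nbar hn) := by
  rw [show orders (g221g nbar hn) = (0, 1) from rfl, show orders (g221f nbar hn) = (1, 1) from rfl,
    show orders (g221b nbar hn) = (0, 3) from rfl]
  decide

/-- **THE SENTENCE FOR THE CLASSES WITH A COUNTERTERM MEMBER**, in the shape print states it: each of the classes {(2.21f), (2.21g)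
with δm²_{(3.6)₃}}, {(2.21d), (2.21g) with δm²_{(3.6)₂}}, {(2.22)₁, (2.22)₂, (2.21g) with δm²_{(3.6)₁}} (p. 430: *"all graphs necessary to
renormalize each divergent subgraph … one counterterm for each graph"*) has one pair of orders throughout.
[cite: Balaban1983Higgs3, p.420, (2.21)–(2.22) p.430] -/
theorem sameOrders_with_counterterm :
    (orders (g221f nbar hn) = (1, 1) ∧ ordersCt (g221g nbar hn) ![(0, 0), orders (g36c nbar)] = (1, 1)) ∧
    (orders (g221d nbar hn2) = (0, 3) ∧ ordersCt (g221g nbar hn) ![(0, 0), orders (g36b nbar hn2)] = (0, 3)) ∧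
    (orders (pic222a hn).G = (0, 3) ∧ orders (pic222b hn).G = (0, 3) ∧
      ordersCt (g221g nbar hn) ![(0, 0), orders (g36a nbar hn)] = (0, 3)) :=
  ⟨⟨rfl, rfl⟩, ⟨rfl, rfl⟩, ⟨rfl, rfl, rfl⟩⟩

/-- The vertex bijection exhibiting (2.21f) as (2.21g) with (3.6)₃ ATTACHED at its vertex (1.7): the vertex `0` of (2.21f)
((1.8)_{0,1}) is the vertex `0` of (2.21g), the vertex `1` ((1.6)) is the vertex of (3.6)₃ ((2.21g), (2.21f) have two vertices,
(3.6)₃ one). [cite: Balaban1983Higgs3, (2.21) p.430, (2.3) p.423] -/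
def attachEquiv221f : {i : Fin 2 // i ≠ 1} ⊕ Fin 1 ≃ Fin 2 where
  toFun
    | .inl _ => 0
    | .inr _ => 1
  invFun i := if i = 0 then .inl ⟨0, by decide⟩ else .inr 0
  left_inv := by decide
  right_inv := by decide

/-- `orders_attach` EXERCISED: (2.21f) = (2.21g) + (3.6)₃ attached ⇒ orders(2.21f) = orders(2.21g) + orders((3.6)₃) = (0,1) + (1,0).
[cite: Balaban1983Higgs3, (2.21) p.430, (2.3) p.423, p.420] -/
theorem orders_g221f_attach (hn : 1 ≤ nbar) :
    orders (g221f nbar hn) = orders (g221g nbar hn) + orders (g36c nbar) :=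
  orders_attach (G := g221g nbar hn) (G₀ := g36c nbar) (G' := g221f nbar hn) (1 : Fin 2) rfl attachEquiv221f
    (fun i => match i with
      | ⟨⟨0, _⟩, _⟩ => rfl
      | ⟨⟨1, _⟩, hi⟩ => absurd rfl hi
      | ⟨⟨k + 2, hk⟩, _⟩ => absurd hk (by change ¬ (k + 2 < 2); omega))
    (fun j => match j with
      | ⟨0, _⟩ => rfl
      | ⟨k + 1, hk⟩ => absurd hk (by change ¬ (k + 1 < 1); omega))

end Counterterm

end Literature.MathematicalPhysics.QuantumFieldTheory.Balaban1983to89.B3ClassOrders420
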